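import Summits.QuantumFields.YangMills.Theorems.TransportPerturbationSynchronousShadowLawTransfer
import Literature.MathematicalPhysics.QuantumFieldTheory.Balaban1983to89.T4ApexTwoLevel
import HarnessLib

/-!
# Route `TransportPerturbation`, LINE 16 «synchronous_shadow» (crux K2 `WeightedAlmostInvariance`, stmt-QuantumFields-26987):
# the shared stub `stub_fineWindowIdentity` IS the route item `GibbsInvariance` (stmt-QuantumFields-26921) tested on `g ∘ descend`

The LINE-16 card (planner ym-idea-5 g11): «`stub_fineWindowIdentity` (M, verbatim r1/r2; = route item GibbsInvariance 26921 tested on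
`g∘descend`)».  This file records that reduction as a theorem:

  `stub_fineWindowIdentity_of_gibbsInvariance : Theses.TransportPerturbation.GibbsInvariance → __Registered.stub_fineWindowIdentity`

— apply Gibbs_{K+1}-invariance of the step-`(K+1)` SZZ dynamics (the route decl `GibbsInvariance` at step `K + 1`) to the bounded
measurable observable `g ∘ descendCfg F K` (measurable by `T3NestedUnitLaws.measurable_descend`, as in the skeleton), and read `descendCfg` on a field through the bond
dictionary (`toField F (K+1) (e ↦ U⟨e.1,e.2⟩) = U`, structure eta).  So the line's crux composition `WeightedAlmostInvariance_of`
needs, besides the load-bearing `stub_synchronousCoupling`, only the route item 26921 (itself reduced in the tree to the named fact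
`WilsonMeasureLangevinInvariant` = SZZ Lemma 3.3, `Theorems.TransportPerturbation.gibbsInvariance_of_wilsonInvariant`, and further to
short-time kernel invariance on continuous observables, `Theorems.ColdStartUniversality.wilsonMeasureLangevinInvariant_of_family`).

Cell `ym-idea-1` extra width seat `ym-line-sfw-p2-w5` gen 9 (free hands).  HONEST FRAMING: a CONDITIONAL reduction — `GibbsInvariance`
(26921) is OPEN, so `stub_fineWindowIdentity` is NOT landed by this file; `stub_synchronousCoupling` (XL) untouched; no crux, item, rung
or summit is proved; the Yang–Mills mass gap is NOT proved by any of this (R3 is a RECORD rung).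
-/

set_option autoImplicit false

noncomputable section

namespace Summit.QuantumFields.YangMills.Cruxes.WeightedAlmostInvariance.SynchronousShadow

open scoped BigOperators Topology Classical MeasureTheory NNReal ENNReal
open Filter Set Function MeasureTheory
open Literature.MathematicalPhysics.QuantumFieldTheory
open Literature.MathematicalPhysics.QuantumFieldTheory.Balaban1983to89
open Literature.MathematicalPhysics.QuantumLattice

variable (F : T3ContinuumYM3Torus.T3Family)

/-- The bond dictionary is inverse to `toField`: reading the configuration `e ↦ U⟨e.1, e.2⟩` of a field `U` back as a field gives `U`
(structure eta for `PBond`). [folklore] -/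
theorem toField_ofField (K : ℕ) (U : GaugeField (F.P K) 0 G2) :
    toField F K (fun e => U ⟨e.1, e.2⟩) = U := by
  funext b
  rfl

/-- `descendCfg` read on a field through the bond dictionary is Bałaban's `descend` of that field. [cite: Balaban1987RG1, (0.4) p.253] -/
theorem descendCfg_ofField (K : ℕ) (U : GaugeField (F.P (K + 1)) 0 G2) :
    descendCfg F K (fun e => U ⟨e.1, e.2⟩) =
      fun e => T3NestedUnitLaws.descend F
        (ExpMeanLog.expMeanLogSU : LoopAverage (Matrix.specialUnitaryGroup (Fin 2) ℂ)) K U ⟨e.1, e.2⟩ := by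
  funext e
  simp only [descendCfg, toField_ofField]

/-- **`stub_fineWindowIdentity` from the route item `GibbsInvariance` (stmt-QuantumFields-26921).**  For every `F`, `γ > 0`, `τ > 0`,
`K`, every jointly measurable strong-solution family `V'` of the step-`(K+1)` SZZ dynamics and every measurable `g` with `|g| ≤ 1`:
`∫ g∘descend dGibbs_{K+1} = ∫ P'_{τ/ε_{K+1}}(g∘descend) dGibbs_{K+1}` — Gibbs_{K+1}-invariance applied to the bounded measurable observable
`g ∘ descendCfg F K`. [cite: ShenZhuZhu2022, §3 Lemma 3.3 (p. 13)] [cite: Balaban1987RG1, (0.4) p.253] -/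
theorem stub_fineWindowIdentity_of_gibbsInvariance
    (hG : Summit.QuantumFields.YangMills.Theses.TransportPerturbation.GibbsInvariance) :
    __Registered.stub_fineWindowIdentity := by
  intro F γ hγ τ hτ K Ω' mΩ' P' hP' W' hW' V' hV' g hgm hg1
  have hV₁ : IsSolFamily F γ (K + 1) P' W' hW' V' := hV'
  have hTo : Measurable (toField F (K + 1)) :=
    measurable_pi_lambda _ (fun b => measurable_pi_apply (b.src, b.dir))
  have hDc : Measurable (descendCfg F K) :=
    measurable_pi_lambda _ (fun e => (measurable_pi_apply (⟨e.1, e.2⟩ : PBond (F.P K) 0)).comp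
      ((T3NestedUnitLaws.measurable_descend F avSU T4ApexTwoLevel.measurableE_expMeanLogSU K).comp hTo))
  have hmeas : Measurable (g ∘ descendCfg F K) := hgm.comp hDc
  have hbd : ∀ u, |(g ∘ descendCfg F K) u| ≤ 1 := fun u => hg1 _
  have h := hG F γ hγ (K + 1) Ω' mΩ' P' hP' W' hW' V' hV₁ (g ∘ descendCfg F K) hmeas hbd
    (τ / (F.P (K + 1)).eps).toNNReal
  rw [h]
  refine integral_congr_ae (ae_of_all _ fun U => ?_)
  show g _ = (g ∘ descendCfg F K) _
  rw [Function.comp_apply, descendCfg_ofField]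

end Summit.QuantumFields.YangMills.Cruxes.WeightedAlmostInvariance.SynchronousShadow

end
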